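import Summits.BirchSwinnertonDyer.BirchSwinnertonDyer.Theorems.PrintX10bTwoSidedLinkAnyClassNumberX10bOfPrintFactsPinnedLevel
import Summits.BirchSwinnertonDyer.BirchSwinnertonDyer.Theorems.PrintX10bHowardContainmentAnyClassNumberX10bThm413Hyp
import Summits.BirchSwinnertonDyer.BirchSwinnertonDyer.Theorems.PrintX10bBeyondCarrierUpperLinkOfPrint
import Summits.BirchSwinnertonDyer.BirchSwinnertonDyer.Theorems.PrintX9MuPartStabilizedWeakLetters
import Summits.BirchSwinnertonDyer.Rank1Residual.X9.LeafDischargeScalarImage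
import Literature.NumberTheory.EllipticCurves.HeegnerGeomCoherentDataOfFrameProofs
import Literature.NumberTheory.EllipticCurves.CastellaGrossiLeeSkinner2022.HowardDivisibilityAnyClassNumber
import Literature.NumberTheory.EllipticCurves.IwasawaAlgebraPromotionProofs
import Literature.NumberTheory.EllipticCurves.HeegnerCharIdealEnvelopeProofs
import Literature.NumberTheory.EllipticCurves.HeegnerCharIdealEnvelopePowTransferProofs
import Literature.NumberTheory.EllipticCurves.BSDSelmerParityDokchitserProofs
import HarnessLib

/-!
# Crux `BeyondCarrierDepthX10b` (stmt-BirchSwinnertonDyer-23055, PrintX10b aside r301), line «twins»: BOTH `U₃` halves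
# WITHOUT the Carayol leaf (finding «hC-IDLE»)

Cell `run/shared/lean/pub/bsd-print-x9/`, seat `bsd-line-x10b-p1-w8` g9 (D-0154 row 10; GO bsd-line-x10b-p1 LEAD g10 01:37:40Z).
HONEST FRAMING: THEOREMS ONLY (no definition, no named fact, no `sorry`); conditional glue `--supports stmt-BirchSwinnertonDyer-23055`
(helper); no `Theses.PrintX10b` import; nothing booked, nothing closed; «beyond-print theorem»: NO. BSD is not proved by any of this
and no summit statement is proved by this seat.

WHY. In the cone of the census of record p681886 the Carayol leaf `hC` («level of the newform of `E` = conductor of `E`»,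
the `IsNewformOf` level fact quantified over every level `N`) is used exactly once — in `CompositeTransferX10b.composite_of_printFacts_of_pinnedTransfer`, to learn `N = N_E` for a parametrisation
datum whose level the caller already pins (`imcWaldspurger…` binds `hN : W.conductorNorm ℤ = N`; the crux binds
`Dt : ModularParametrizationData W (W.conductorNorm ℤ)`). The hC-free pinned-transfer lemmas are p686788
(`…OfPrintFactsPinnedLevel.lean`); this file re-threads the two `U₃` halves over them, signatures = the landed ones MINUS `hC`:
* `UpperHalf.upperLinkX10b_coprimeClassNumber_of_pinnedPrintFacts_of_level (h46 h57 h59gp h422 h513 h331)` — the `3 ∤ h_K` frames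
  (twin of p609477);
* `HowardFrames.upperLinkX10b_divisibleClassNumber_of_muPartStabilizedCoherentPair_of_printFacts_of_level
  (hNV hCGLS hTw h57 h59gp h422 h513 h331 hμ)` — the `3 ∣ h_K` frames from the coherent-pair μ-letter (twin of p631498 §1).
The BY-NAME composition and the census forms (13 leaves −hC; 12 leaves −hC −hCG) follow in the Theses-side companion
`PrintX10bBeyondCarrierOfTwelvePrintLeaves.lean`. Proofs verbatim (LEAD g3/g4 and REF-107 lineage), one lemma name changed each.

References: [MastellaZerman2026] Cor. 4.6; [CastellaGrossiLeeSkinner2022] Thm. 4.1.1, Rem. 4.1.4, Thm. 4.1.3, Cor. 3.4.2, Thm. 5.1.3;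
[YanZhu2024MainConjNonCM] Thm. 5.7 (1), 5.9; [BurungaleCastellaSkinner2025] Prop. 4.2.2; [JetchevSkinnerWan2017] Thm. 3.3.1;
[Howard2004HeegnerKolyvagin] Thm. 2.2.10 (proof), §3.3; [Castella2018] §5; [LombardoTronto2022] Prop. 3.12; [Carayol1986] (idle).
-/

-- the REGISTERED stub namespace `Summit.BirchSwinnertonDyer.BirchSwinnertonDyer.Cruxes.…` repeats the summit name
set_option linter.dupNamespace false
set_option autoImplicit false

noncomputable section

open scoped Classical Pointwise

open WeierstrassCurve NumberField IsDedekindDomain Field Literature.NumberTheory.EllipticCurves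
  Literature.NumberTheory.EllipticCurves.ModularForms Literature.NumberTheory.EllipticCurves.Rank1Residual
  Literature.NumberTheory.EllipticCurves.Castella2018 Literature.NumberTheory.EllipticCurves.YanZhu2026
  Literature.NumberTheory.EllipticCurves.CastellaGrossiLeeSkinner2022
  Literature.NumberTheory.EllipticCurves.JetchevSkinnerWan2017

open Summit.BirchSwinnertonDyer.Rank1Residual
open Summit.BirchSwinnertonDyer.BirchSwinnertonDyer.Rank1Residual
  (X10.thm413Hypotheses_of_classX10 X10.heegnerContainmentPinned_of_cor46_of_not_surj)
open Summit.BirchSwinnertonDyer.BirchSwinnertonDyer.Cruxes.TwoSidedLinkAnyClassNumberX10b.CompositeTransferX10b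
  (imcWaldspurgerOnTreeGoodAt_inducedPlace_of_printFacts_of_pinnedTransfer_of_level)
open Summit.BirchSwinnertonDyer.BirchSwinnertonDyer.Theorems.HeegnerMuPartStabilized (MuPartStabilizedCoherentPair)

/-! ## §1 The `3 ∤ h_K` frames (Mastella–Zerman Cor. 4.6, pinned road) -/

namespace Summit.BirchSwinnertonDyer.BirchSwinnertonDyer.Cruxes.BeyondCarrierDepthX10b.UpperHalf

/-- **U₃ on the `3 ∤ h_K` X10b frames through the PINNED road, WITHOUT the Carayol leaf** — verbatim
`upperLinkX10b_coprimeClassNumber_of_pinnedPrintFacts` (p609477, this namespace) with the binder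
`hC` (Carayol: newform level = conductor, over every level `N`) DELETED: Mastella–Zerman 2026 Cor. 4.6 at `3` for a Heegner
family TIED to `Dt` (`X10.heegnerContainmentPinned_of_cor46_of_not_surj`, needs `3 ∤ h_K`) ⟹ the two-sided link at the
induced place from the pinned class-number-free facts, now via the hC-free
`imcWaldspurgerOnTreeGoodAt_inducedPlace_of_printFacts_of_pinnedTransfer_of_level` (p686788; the level of `Dt` is
`N_E` by `rfl` on this binder list) ⟹ its `≤` half (`upperLink_of_imcWaldspurgerOnTreeGoodAt`). Facts: `h46` (MZ26
Cor. 4.6), `h57` (Yan–Zhu Thm. 5.7 (1)), `h59gp` (the pinned transfer), `h422` (BCS Prop. 4.2.2), `h513` (CGLS Thm. 5.1.3),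
`h331` (JSW Thm. 3.3.1) — six, not seven. CONDITIONAL; credits nothing.
[cite: MastellaZerman2026, Cor. 4.6] [cite: YanZhu2024MainConjNonCM, Thm. 5.7 (1) and Thm. 5.9]
[cite: BurungaleCastellaSkinner2025, Prop. 4.2.2] [cite: CastellaGrossiLeeSkinner2022, Thm. 5.1.3]
[cite: JetchevSkinnerWan2017, Thm. 3.3.1] [cite: Castella2018, §5 (eq:IMC+BDP)] -/
theorem upperLinkX10b_coprimeClassNumber_of_pinnedPrintFacts_of_level
    (h46 : MastellaZerman2026.cor46_howardDivisibility_of_scalarImage.{0})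
    (h57 : thm57_isTorsion_charIdealXGr_eq_bdpLFunction)
    (h59gp : ∀ {p : ℕ} [Fact p.Prime] (ι' : PadicAlgCl p ≃+* ℂ) (W : WeierstrassCurve ℚ) [W.IsElliptic]
      [W.IsGloballyMinimal] (K : Type) [Field K] [NumberField K] (v vbar : HeightOneSpectrum (𝓞 K))
      (κ : ZpExtension K p) (γ : absoluteGaloisGroup K) [Fact (κ.IsTopGenerator γ)] {N : ℕ} [NeZero N]
      {f : CuspForm (CongruenceSubgroup.Gamma0 N) 2} (jbar : AlgebraicClosure K →+* ℂ)
      (_ : IsNewformOf W f),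
      N = W.conductorNorm ℤ → 3 ≤ p → GoodOrd W p → (W.baseChange K).HasIrreducibleModPGaloisRep p →
      IsImaginaryQuadratic K → SatisfiesHeegnerHypothesis N K →
        ((Ideal.span {(p : ℤ)}).primesOver (𝓞 K)).ncard = 2 →
        Odd (NumberField.discr K) → NumberField.discr K ≠ -3 → κ.IsAnticyclotomic →
      (∀ (w : InfinitePlace K) (k : 𝓞 K), k ∈ v.asIdeal ↔ ‖ι'.symm (w.embedding (k : K))‖ < 1) →
        ((p : ℕ) : 𝓞 K) ∈ vbar.asIdeal → vbar ≠ v →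
      ∃ (ΩK : ℂ) (Ωp : (unrIntegers p)ˣ) (L : UnrSeries p),
        ΩK ≠ 0 ∧ IsBDPLFunction ι' v κ γ f ΩK ((Ωp : unrIntegers p) : ℂ_[p]) L ∧
        ∀ (D : (W.baseChange K).LambdaAdicSelmerData κ γ) (F : HeegnerFamily N W K κ jbar)
          (X : (W.baseChange K).SelmerDualData κ γ) (j : ℤ_[p] →+* unrIntegers p),
          ¬ (p : ℤ) ∣ F.Dt.c →
          (∀ x : ℤ_[p], ((j x : unrIntegers p) : ℂ_[p]) = algebraMap ℚ_[p] ℂ_[p] (x : ℚ_[p])) →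
          heegnerCharIdeal D F ^ 2 ≤
              Module.charIdeal (IwasawaAlgebra p) (Submodule.torsion (IwasawaAlgebra p) X.X) →
            L ∈ (AcSelmer.XAc.charIdeal (W.baseChange K) p κ vbar ∅ γ).map (PowerSeries.map j))
    (h422 : BurungaleCastellaSkinner2025.prop422_exists_isBDPLFunction_mu_eq_zero)
    (h513 : thm513_exists_isBDPLFunction_valueAtOne_disc)
    (h331 : thm331_anticyclotomicControl) :
    ∀ (W : WeierstrassCurve ℚ) [W.IsElliptic] [W.IsGloballyMinimal] (p : ℕ) [Fact p.Prime]
    [NeZero (W.conductorNorm ℤ)] (K : Type) [Field K] [NumberField K],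
    Literature.NumberTheory.EllipticCurves.Rank1Residual.ClassX10 W p →
    ¬ Literature.NumberTheory.EllipticCurves.Rank1Residual.Surj W 3 → ¬ W.HasCM →
    Literature.NumberTheory.EllipticCurves.IsImaginaryQuadratic K → Odd (NumberField.discr K) →
    NumberField.discr K ≠ -3 →
    Literature.NumberTheory.EllipticCurves.SatisfiesHeegnerHypothesis (W.conductorNorm ℤ) K →
    Literature.NumberTheory.EllipticCurves.SatisfiesHeegnerHypothesis p K →
    (W.baseChange K).HasIrreducibleModPGaloisRep p → ¬ p ∣ NumberField.classNumber K →
    ∀ (ι : K →+* ℚ_[p]) (κ : Literature.NumberTheory.EllipticCurves.ZpExtension K p), κ.IsAnticyclotomic →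
    ∀ (γ : Field.absoluteGaloisGroup K) [Fact (κ.IsTopGenerator γ)]
      (Dt : Literature.NumberTheory.EllipticCurves.ModularForms.ModularParametrizationData W
        (W.conductorNorm ℤ)), ¬ (p : ℤ) ∣ Dt.c →
    ∀ (H : Literature.NumberTheory.EllipticCurves.HeegnerDatum (W.conductorNorm ℤ) (NumberField.discr K))
      (ιC : K →+* ℂ) (P : (W.baseChange K).toAffine.Point),
      WeierstrassCurve.Affine.Point.map ιC.toRatAlgHom P =
        Literature.NumberTheory.EllipticCurves.ModularForms.heegnerPointComplex Dt H →
      (W.baseChange K).mordellWeilRank = 1 →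
      Finite (AddCommGroup.primaryComponent (W.baseChange K).sha p) → ¬ IsOfFinAddOrder P →
    ∃ n : ℕ, Summit.BirchSwinnertonDyer.Rank1Residual.X11b.AcSelmer.XAc.HasCharValuationAt
        (W.baseChange K) p κ (Summit.BirchSwinnertonDyer.Rank1Residual.X11b.inducedPlace ι) ∅ γ n ∧
      (n : ℤ) ≤ 2 * (Summit.BirchSwinnertonDyer.Rank1Residual.X11b.padicLogOrd W p ι P +
        (padicValInt p (1 - W.frobeniusTrace p + p) : ℤ) - 1) := by
  intro W _ _ p _ _ K _ _ hX hns hcm hK hodd h3 hHN hHp hirrK hhK ι κ hκ γ _ Dt hc H ιC P hP hrk hfinp hPinf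
  obtain ⟨hp3, hord, -, -⟩ := id hX
  subst hp3
  have h4 : NumberField.discr K ≠ -4 := by
    rintro h
    rw [h] at hodd
    exact absurd hodd (by decide)
  -- an embedding `K̄ → ℂ` over `ιC` for the tied family
  letI : Algebra K ℂ := ιC.toAlgebra
  let jbar : AlgebraicClosure K →+* ℂ :=
    (IsAlgClosed.lift (R := K) (M := ℂ) (S := AlgebraicClosure K)).toRingHom
  -- Howard's containment for a family TIED to `Dt` (Mastella–Zerman Cor. 4.6 at `3`, needs `3 ∤ h_K`)
  obtain ⟨D, F, X, hFD, -, hle⟩ := X10.heegnerContainmentPinned_of_cor46_of_not_surj h46 hX hns hcm hK h3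
    h4 hHN hHp hhK κ hκ γ Fact.out Dt H jbar
  -- the pinned class-number-free two-sided link at the induced place, then its `≤` half
  exact upperLink_of_imcWaldspurgerOnTreeGoodAt
    (imcWaldspurgerOnTreeGoodAt_inducedPlace_of_printFacts_of_pinnedTransfer_of_level h57 h59gp h422 h513 h331
      le_rfl hord hK hodd h3 rfl hHN hHp hirrK ι κ hκ γ Dt hc H ιC P hP hrk hfinp hPinf
      ⟨jbar, D, F, X, hFD, hle⟩)

end Summit.BirchSwinnertonDyer.BirchSwinnertonDyer.Cruxes.BeyondCarrierDepthX10b.UpperHalf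

/-! ## §2 The `3 ∣ h_K` frames (coherent-pair μ-letter L∃) -/

namespace Summit.BirchSwinnertonDyer.BirchSwinnertonDyer.Cruxes.BeyondCarrierDepthX10b.HowardFrames

open Summit.BirchSwinnertonDyer.BirchSwinnertonDyer.Cruxes.BeyondCarrierDepthX10b.UpperHalf
  (upperLink_of_imcWaldspurgerOnTreeGoodAt)

/-- **U₃ on the `3 ∣ h_K` X10b frames from the COHERENT-PAIR μ-letter (L∃), WITHOUT the Carayol leaf** — verbatim
`upperLinkX10b_divisibleClassNumber_of_muPartStabilizedCoherentPair_of_printFacts` (p631498) with the binder `hC`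
DELETED (the pinned transfer is reached through the hC-free `imcWaldspurgerOnTreeGoodAt_…_of_level`, p686788).
Inputs: `hNV` CGLS Thm. 4.1.1; `hCGLS` CGLS Thm. 4.1.3 localized; `hTw` the tower clause `K_k ⊆ K[p^{k+1}]` (a tree
theorem, `anticyclotomicTowerSharp`, kept as a binder here as in the source); `h57 h59gp h422 h513 h331` the pinned
class-number-free transfer inputs; `hμ` the letter `MuPartStabilizedCoherentPair`. Chain unchanged: data `D`, `X` by the
tree's existence theorems; `(C, F)` on `(Dt, H.β)` and the μ-inequality at that `C` from the letter; torsion of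
`𝔖/Λκ_∞(C)` (Thm. 4.1.1) and of `𝔖/ℋ_∞(F)`; CGLS Thm. 4.1.3 at `(D, C, X)`; promotion `I(Λκ_∞(C))² ⊆ char_Λ(𝒳_tors)`;
`I(ℋ_∞(F)) ⊆ I(Λκ_∞(C))`; pinned transfer; `≤` half. CONDITIONAL; credits nothing.
[cite: CastellaGrossiLeeSkinner2022, Thm. 4.1.1, Rem. 4.1.4, Thm. 4.1.3 and Cor. 3.4.2] [cite: Washington1997, §13.2]
[cite: Howard2004HeegnerKolyvagin, Thm. 2.2.10 (proof) and §3.3] [cite: YanZhu2024MainConjNonCM, Thm. 5.7 (1) and Thm. 5.9]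
[cite: BurungaleCastellaSkinner2025, Prop. 4.2.2] [cite: JetchevSkinnerWan2017, Thm. 3.3.1] [cite: Castella2018, §5 (eq:IMC+BDP)]
[cite: LombardoTronto2022, Prop. 3.12] -/
theorem upperLinkX10b_divisibleClassNumber_of_muPartStabilizedCoherentPair_of_printFacts_of_level
    (hNV : thm411_torsionFree_heegnerClass_ne_bot_quotient_isTorsion.{0})
    (hCGLS : thm413_rankOne_charIdeal_torsion_dvd_localized.{0})
    (hTw : ∀ (K : Type) [Field K] [NumberField K] (p : ℕ) [Fact p.Prime], Odd p →
      Literature.NumberTheory.EllipticCurves.IsImaginaryQuadratic K →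
      ∀ (κ : Literature.NumberTheory.EllipticCurves.ZpExtension K p), κ.IsAnticyclotomic →
      ∀ (jbar : AlgebraicClosure K →+* ℂ) (k : ℕ),
      Literature.NumberTheory.EllipticCurves.ringClassSubgroup K (p ^ (k + 1)) jbar ≤ κ.layerSubgroup k)
    (h57 : thm57_isTorsion_charIdealXGr_eq_bdpLFunction)
    (h59gp : ∀ {p : ℕ} [Fact p.Prime] (ι' : PadicAlgCl p ≃+* ℂ) (W : WeierstrassCurve ℚ) [W.IsElliptic]
      [W.IsGloballyMinimal] (K : Type) [Field K] [NumberField K] (v vbar : HeightOneSpectrum (𝓞 K))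
      (κ : ZpExtension K p) (γ : absoluteGaloisGroup K) [Fact (κ.IsTopGenerator γ)] {N : ℕ} [NeZero N]
      {f : CuspForm (CongruenceSubgroup.Gamma0 N) 2} (jbar : AlgebraicClosure K →+* ℂ)
      (_ : IsNewformOf W f),
      N = W.conductorNorm ℤ → 3 ≤ p → GoodOrd W p → (W.baseChange K).HasIrreducibleModPGaloisRep p →
      IsImaginaryQuadratic K → SatisfiesHeegnerHypothesis N K →
        ((Ideal.span {(p : ℤ)}).primesOver (𝓞 K)).ncard = 2 →
        Odd (NumberField.discr K) → NumberField.discr K ≠ -3 → κ.IsAnticyclotomic →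
      (∀ (w : InfinitePlace K) (k : 𝓞 K), k ∈ v.asIdeal ↔ ‖ι'.symm (w.embedding (k : K))‖ < 1) →
        ((p : ℕ) : 𝓞 K) ∈ vbar.asIdeal → vbar ≠ v →
      ∃ (ΩK : ℂ) (Ωp : (unrIntegers p)ˣ) (L : UnrSeries p),
        ΩK ≠ 0 ∧ IsBDPLFunction ι' v κ γ f ΩK ((Ωp : unrIntegers p) : ℂ_[p]) L ∧
        ∀ (D : (W.baseChange K).LambdaAdicSelmerData κ γ) (F : HeegnerFamily N W K κ jbar)
          (X : (W.baseChange K).SelmerDualData κ γ) (j : ℤ_[p] →+* unrIntegers p),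
          ¬ (p : ℤ) ∣ F.Dt.c →
          (∀ x : ℤ_[p], ((j x : unrIntegers p) : ℂ_[p]) = algebraMap ℚ_[p] ℂ_[p] (x : ℚ_[p])) →
          heegnerCharIdeal D F ^ 2 ≤
              Module.charIdeal (IwasawaAlgebra p) (Submodule.torsion (IwasawaAlgebra p) X.X) →
            L ∈ (AcSelmer.XAc.charIdeal (W.baseChange K) p κ vbar ∅ γ).map (PowerSeries.map j))
    (h422 : BurungaleCastellaSkinner2025.prop422_exists_isBDPLFunction_mu_eq_zero)
    (h513 : thm513_exists_isBDPLFunction_valueAtOne_disc)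
    (h331 : thm331_anticyclotomicControl)
    (hμ : MuPartStabilizedCoherentPair) :
    ∀ (W : WeierstrassCurve ℚ) [W.IsElliptic] [W.IsGloballyMinimal] (p : ℕ) [Fact p.Prime]
    [NeZero (W.conductorNorm ℤ)] (K : Type) [Field K] [NumberField K],
    Literature.NumberTheory.EllipticCurves.Rank1Residual.ClassX10 W p →
    ¬ Literature.NumberTheory.EllipticCurves.Rank1Residual.Surj W 3 → ¬ W.HasCM →
    Literature.NumberTheory.EllipticCurves.IsImaginaryQuadratic K → Odd (NumberField.discr K) →
    NumberField.discr K ≠ -3 →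
    Literature.NumberTheory.EllipticCurves.SatisfiesHeegnerHypothesis (W.conductorNorm ℤ) K →
    Literature.NumberTheory.EllipticCurves.SatisfiesHeegnerHypothesis p K →
    p ∣ NumberField.classNumber K →
    (W.baseChange K).HasIrreducibleModPGaloisRep p →
    ∀ (ι : K →+* ℚ_[p]) (κ : Literature.NumberTheory.EllipticCurves.ZpExtension K p), κ.IsAnticyclotomic →
    ∀ (γ : Field.absoluteGaloisGroup K) [Fact (κ.IsTopGenerator γ)]
    (Dt : Literature.NumberTheory.EllipticCurves.ModularForms.ModularParametrizationData W
    (W.conductorNorm ℤ)), ¬ (p : ℤ) ∣ Dt.c →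
    ∀ (H : Literature.NumberTheory.EllipticCurves.HeegnerDatum (W.conductorNorm ℤ) (NumberField.discr K))
    (ιC : K →+* ℂ) (P : (W.baseChange K).toAffine.Point),
    WeierstrassCurve.Affine.Point.map ιC.toRatAlgHom P =
    Literature.NumberTheory.EllipticCurves.ModularForms.heegnerPointComplex Dt H →
    (W.baseChange K).mordellWeilRank = 1 →
    Finite (AddCommGroup.primaryComponent (W.baseChange K).sha p) → ¬ IsOfFinAddOrder P →
    ∃ n : ℕ, Summit.BirchSwinnertonDyer.Rank1Residual.X11b.AcSelmer.XAc.HasCharValuationAt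
    (W.baseChange K) p κ (Summit.BirchSwinnertonDyer.Rank1Residual.X11b.inducedPlace ι) ∅ γ n ∧
    (n : ℤ) ≤ 2 * (Summit.BirchSwinnertonDyer.Rank1Residual.X11b.padicLogOrd W p ι P +
    (padicValInt p (1 - W.frobeniusTrace p + p) : ℤ) - 1) := by
  intro W _ _ p _ _ K _ _ hX hns hcm hK hodd h3 hHN hHp hhK hirr ι κ hκ γ _ Dt hc H ιC P hP hrk hfin hPinf
  have hγ : κ.IsTopGenerator γ := Fact.out
  have hp : p.Prime := Fact.out
  have hp_odd : Odd p := hp.odd_of_ne_two hX.ne_two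
  -- an embedding `K̄ → ℂ` over `ιC` for the tied family
  letI : Algebra K ℂ := ιC.toAlgebra
  let jbar : AlgebraicClosure K →+* ℂ :=
    (IsAlgClosed.lift (R := K) (M := ℂ) (S := AlgebraicClosure K)).toRingHom
  -- the data exist (tree theorems)
  obtain ⟨D⟩ := WeierstrassCurve.LambdaAdicSelmerDataExists.nonempty_lambdaAdicSelmerData (W.baseChange K) p κ hγ
  obtain ⟨X⟩ := (W.baseChange K).nonempty_selmerDualData_holds κ γ hγ
  have hyp := X10.thm413Hypotheses_of_classX10 hX hK h3 hHN hHp hodd hκ hγ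
  -- the coherent pair `(C, F)` on `(Dt, H.β)` AND the μ-inequality at that `C`, both from the letter
  obtain ⟨C, F, -, hFDt, -, -, hfwd, ⟨g, hg, hrev⟩, hineq⟩ :=
    hμ (W.conductorNorm ℤ) W K p κ γ jbar hyp hcm hX.irr hirr (hX.hasPadicScalarImage_of_not_surj hns) hHp hhK
      (ClassX10.not_dvd_conductorNorm hX) (fun k ↦ hTw K p hp_odd hK κ hκ jbar k)
      (card_ringClassGalOver_prime_one_of_frame hK hodd h3 hp hHp jbar) Dt H.β H.dvd_sq_sub D X
  -- `𝔖/Λκ_∞(C)` torsion (Thm. 4.1.1), transported to `𝔖/ℋ_∞(F)` along the reverse envelope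
  have htorC : Module.IsTorsion (IwasawaAlgebra p) (D.S ⧸ stabilizedHeegnerModule D C) :=
    isTorsion_quotient_stabilizedHeegnerModule_of_thm411 hNV hyp D C
  have htorF : Module.IsTorsion (IwasawaAlgebra p) (D.S ⧸ heegnerModule D F) :=
    isTorsion_quotient_heegnerModule_of_smul_stabilizedHeegnerModule_le D F C hg hrev htorC
  -- CGLS Thm. 4.1.3 at `(D, C, X)`
  obtain ⟨⟨hfinS, -⟩, hfinX, -⟩ := hCGLS (W.conductorNorm ℤ) W K p κ γ jbar hyp D C X
  obtain ⟨m, hm⟩ := span_pow_mul_sq_le_charIdeal_torsion_of_thm413 hCGLS hyp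
    (by -- Selmer corank one on a rank-one frame with finite `Ш[p^∞]` (Greenberg LNM 1716 §1, tree theorem)
      haveI := hfin
      have h0 : (W.baseChange K).shaCorank p = 0 :=
        Literature.NumberTheory.EllipticCurves.zpCorank_eq_zero_of_finite _ p
      rw [(W.baseChange K).selmerCorank_eq_mordellWeilRank_add_holds p, hrk, h0]) D C X
  haveI := hfinX
  haveI := hfinS
  haveI : IsNoetherian (IwasawaAlgebra p) X.X := isNoetherian_of_isNoetherianRing_of_finite _ _
  haveI : Module.Finite (IwasawaAlgebra p) (Submodule.torsion (IwasawaAlgebra p) X.X) := inferInstance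
  haveI : Module.Finite (IwasawaAlgebra p) (D.S ⧸ stabilizedHeegnerModule D C) := inferInstance
  -- the μ-part IN THE STABILISED CURRENCY at the letter's own `C`: promotion
  have hleC : stabilizedHeegnerCharIdeal D C ^ 2 ≤
      Module.charIdeal (IwasawaAlgebra p) (Submodule.torsion (IwasawaAlgebra p) X.X) :=
    IwasawaAlgebra.sq_charIdeal_le_charIdeal_of_span_p_pow_mul_le_of_lengthAt_le_two_mul
      (Submodule.torsion_isTorsion (R := IwasawaAlgebra p) (M := X.X)) htorC (hineq hfinS hfinX htorC) hm
  -- the forward envelope LAST: `I(ℋ_∞(F)) ⊆ I(Λκ_∞(C))`, so the TIED containment holds for `F`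
  have hle : heegnerCharIdeal D F ^ 2 ≤
      Module.charIdeal (IwasawaAlgebra p) (Submodule.torsion (IwasawaAlgebra p) X.X) :=
    (Ideal.pow_right_mono (heegnerCharIdeal_le_stabilizedHeegnerCharIdeal_of_le D F C htorF hfwd) 2).trans hleC
  -- the pinned class-number-free transfer, then the `≤` half
  obtain ⟨hp3, hord, -, -⟩ := id hX
  subst hp3
  exact upperLink_of_imcWaldspurgerOnTreeGoodAt
    (imcWaldspurgerOnTreeGoodAt_inducedPlace_of_printFacts_of_pinnedTransfer_of_level h57 h59gp h422 h513 h331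
      le_rfl hord hK hodd h3 rfl hHN hHp hirr ι κ hκ γ Dt hc H ιC P hP hrk hfin hPinf ⟨jbar, D, F, X, hFDt, hle⟩)

end Summit.BirchSwinnertonDyer.BirchSwinnertonDyer.Cruxes.BeyondCarrierDepthX10b.HowardFrames

end
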